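import Summits.Ventures.CertifiedManyBodySolver.Downfold.EmerySlopeArithSound
import Summits.Ventures.CertifiedManyBodySolver.Downfold.EmeryBandJet
import Summits.Ventures.CertifiedManyBodySolver.Downfold.EmeryOrbitalWeightCheck
import HarnessLib

/-!
# THE WHOLE-BAND (OBJECT-M) ONE-BAND SET OF A σ BOX AS CERTIFIED WINDOWS: the nodal 2-jet `(t_J, t′_J/t_J, t″_J/t_J)` of `EmeryBandJet`
# FACTORISED AT THE NODE, as a straight-line program for the slope-arithmetic device; the window leaf `jetLeaf`; the box theorem
# `jetWindow_of_deep` (INFL-3to1-B §B.101)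

Venture CertifiedManyBodySolver, cell `pub/hubbard-downfold` (stage S1; INFLATION-RULES-3to1-B §B.101), seat hubbard-downfold-mod-4 (technique B = band
level, g45); namespace `Summit.Ventures.CertifiedManyBodySolver.Downfold.Emery`. Everything PROVED (0 sorry). WHAT THIS IS NOT: a statement about any
material; no number lives here; `U = 0` one-body kinematics of the σ model (the jet is the whole-band / object-M reading of ONE σ band, §B.100).

* §1 THE JET FACTORISED AT THE NODE (exact algebra, any energy `ε`, `x₀ = xNode(ε) = ε(Δ+ε)/(2fsN1)`): `∂_εF(x₀, x₀, ε) = (Δ + 2ε − 4(t_pp − t_pp′)x₀)·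
  (Δ + ε + 4(t_pp + t_pp′)x₀)` (`jetFe_node` — the energy derivative of the diagonal factorisation `F(x, x, ε) = (fsD1 − 2fsN1·x)(Δ + ε + 4(t_pp + t_pp′)x)`
  at its first factor's zero), `gradX(x₀, ε) = 4(Δ + ε)(t_pd² + t_pp ε)` (`gradX_node`), `16fsN = 8(t_pp + t_pp′)fsN1`; with `nodeV = (dgradX − taylor2·jetP)/∂_εF`,
  `nodeW = 16fsN/gradX`, `nodeK = 1 + (4jetV + nodeW)(1/2 − x₀)`: **`t″_J = −jetP·nodeV/16`** (`jetTpp_eq_nodeV`), **`t′_J = −jetP(nodeW + 2jetV)/16`**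
  (`jetTp_eq_nodeW`), **`t_J = jetP·nodeK/4`** (`jetT_eq_nodeK`), hence `t″_J/t_J = −nodeV/(4jetK)`, `t′_J/t_J = −(nodeW + 2jetV)/(4jetK)` (`jetRatios_eq`) — the
  common factor `jetP` cancels EXACTLY, which is what makes the ratios well-conditioned for interval evaluation.
* §2 `jetProg` — these formulas as a `Prog` of `EmerySlopeArith` in `(Δ, t_pd, t_pp, t_pp′, ε)`; `jetStack` = the same fourteen reals by name; **`jetProg_eval`**:
  the real semantics of the program IS that stack (needs only `fsN1 ≠ 0`; fourteen one-line `ring` steps — the transcription is checked, not trusted).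
* §3 `JWin` (six scaled integers: windows for `t_J` in eV, `ρ′ = t′_J/t_J`, `ρ″ = t″_J/t_J`), the leaf **`jetLeaf W B`** (run `Prog.evalS` on `(B, B.cen)`; check
  `fsN1, gradX, ∂_εF, nodeK > 0` on the enclosures and the three windows), its soundness `jetIn_of_jetLeaf`, and **`jetWindow_of_deep`**:
  `Box5.deep (jetLeaf W) n B = true` ⇒ for every `(Δ, t_pd, t_pp, t_pp′, ε) ∈ B`, with `x₀ = xNode(ε)`: `t_J ∈ [tlo, thi]/2⁴⁸`, `t′_J/t_J ∈ [p1lo, p1hi]/2⁴⁸`,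
  `t″_J/t_J ∈ [p2lo, p2hi]/2⁴⁸` (`JetIn`).
* §4 `fiIcc p₁ q₁ p₂ q₂` (the `FI` spanning `[p₁/q₁, p₂/q₂]`) with `mem_fiIcc_of_le` — how consumers feed a typed box and an ε_F bracket.

Consumers: `EmeryBoxesLa214JetWindow*` (box #18 per sub-box and assembled). Sources: [AndersenEtAl1995, §6 and Eq. (24)]; [PavariniEtAl2001, Eq. (1)];
[HybertsenSchluterChristensen1989, Eq. (1)]; interval/slope arithmetic [folklore].
-/

noncomputable section

namespace Summit.Ventures.CertifiedManyBodySolver.Downfold.Emery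

open Real Set Literature.Analysis.ValidatedNumerics.Numerics

/-! ## §1 The jet factorised at the node -/

/-- `nodeV = (dgradX − taylor2·jetP)/∂_εF` — the velocity-normalised energy-dependence combination (`t″_J = −jetP·nodeV/16`). [folklore] -/
def nodeV (Δ tpd tpp c x₀ ε : ℝ) : ℝ :=
  (dgradX Δ tpd tpp c x₀ ε - taylor2 Δ c x₀ x₀ ε * jetP Δ tpd tpp c x₀ x₀ ε) / dcharCubic Δ tpd tpp c x₀ x₀ ε

/-- `nodeW = 16fsN/gradX` — the contour's `xy` weight over the gradient (`t′_J − 2t″_J = −jetP·nodeW/16`). [folklore] -/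
def nodeW (Δ tpd tpp c x₀ ε : ℝ) : ℝ := 16 * fsN tpd tpp c ε / gradX Δ tpd tpp c x₀ ε

/-- `nodeK = 1 + (4jetV + nodeW)(1/2 − x₀)` — the re-centring factor (`t_J = jetP·nodeK/4`; `= 1` on the nesting line `x₀ = 1/2`). [folklore] -/
def nodeK (Δ tpd tpp c x₀ ε : ℝ) : ℝ := 1 + (4 * nodeV Δ tpd tpp c x₀ ε + nodeW Δ tpd tpp c x₀ ε) * (1 / 2 - x₀)

/-- **`∂_εF` AT THE NODE IS A PRODUCT**: `dcharCubic(x₀, x₀, ε) = (Δ + 2ε − 4(t_pp − t_pp′)x₀)(Δ + ε + 4(t_pp + t_pp′)x₀)` at `x₀ = xNode(ε)` (`fsN1 ≠ 0`).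
[cite: AndersenEtAl1995, Eq. (24)] -/
theorem jetFe_node (Δ tpd tpp c ε : ℝ) (hn : fsN1 tpd tpp c ε ≠ 0) :
    (Δ + 2 * ε - 4 * (tpp - c) * xNode Δ tpd tpp c ε) * (Δ + ε + 4 * (tpp + c) * xNode Δ tpd tpp c ε) =
      dcharCubic Δ tpd tpp c (xNode Δ tpd tpp c ε) (xNode Δ tpd tpp c ε) ε := by
  have hx : xNode Δ tpd tpp c ε * (2 * fsN1 tpd tpp c ε) = ε * (Δ + ε) := by
    unfold xNode fsD1; field_simp
  unfold fsN1 at hx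
  unfold dcharCubic dcA dfsD dfsN
  linear_combination hx

/-- **`gradX` AT THE NODE**: `4fsD + 16fsN·x₀ = 4(Δ + ε)(t_pd² + t_pp ε)` at `x₀ = xNode(ε)` (`fsN1 ≠ 0`). [folklore] -/
theorem gradX_node (Δ tpd tpp c ε : ℝ) (hn : fsN1 tpd tpp c ε ≠ 0) :
    4 * (Δ + ε) * (tpd ^ 2 + tpp * ε) = gradX Δ tpd tpp c (xNode Δ tpd tpp c ε) ε := by
  have hx : xNode Δ tpd tpp c ε * (2 * fsN1 tpd tpp c ε) = ε * (Δ + ε) := by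
    unfold xNode fsD1; field_simp
  unfold fsN1 at hx
  unfold gradX fsD fsN
  linear_combination (-4 * (tpp + c)) * hx

/-- `16fsN = 8(t_pp + t_pp′)·fsN1`. [folklore] -/
theorem sixteen_fsN_eq (tpd tpp c ε : ℝ) : 16 * fsN tpd tpp c ε = 8 * (tpp + c) * fsN1 tpd tpp c ε := by
  unfold fsN fsN1; ring

/-- **`t″_J = −jetP·nodeV/16`** (any diagonal point, any energy). [folklore] -/
theorem jetTpp_eq_nodeV (Δ tpd tpp c x₀ ε : ℝ) :
    jetTpp Δ tpd tpp c x₀ ε = -(jetP Δ tpd tpp c x₀ x₀ ε * nodeV Δ tpd tpp c x₀ ε) / 16 := by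
  unfold jetTpp jetR nodeV
  ring

/-- **`t′_J = −jetP·(nodeW + 2jetV)/16`** (`gradX ≠ 0`). [folklore] -/
theorem jetTp_eq_nodeW {Δ tpd tpp c x₀ ε : ℝ} (hg : gradX Δ tpd tpp c x₀ ε ≠ 0) :
    jetTp Δ tpd tpp c x₀ ε = -(jetP Δ tpd tpp c x₀ x₀ ε * (nodeW Δ tpd tpp c x₀ ε + 2 * nodeV Δ tpd tpp c x₀ ε)) / 16 := by
  unfold jetTp jetS nodeV nodeW jetQ jetP
  field_simp
  ring

/-- **`t_J = jetP·nodeK/4`** (`gradX, ∂_εF ≠ 0`). [folklore] -/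
theorem jetT_eq_nodeK {Δ tpd tpp c x₀ ε : ℝ} (hg : gradX Δ tpd tpp c x₀ ε ≠ 0) (hF : dcharCubic Δ tpd tpp c x₀ x₀ ε ≠ 0) :
    jetT Δ tpd tpp c x₀ ε = jetP Δ tpd tpp c x₀ x₀ ε * nodeK Δ tpd tpp c x₀ ε / 4 := by
  unfold jetT nodeK jetS jetR nodeV nodeW jetQ jetP
  field_simp
  ring

/-- **THE RATIOS WITH `jetP` CANCELLED**: `t″_J/t_J = −nodeV/(4jetK)` and `t′_J/t_J = −(nodeW + 2jetV)/(4jetK)` (`gradX, ∂_εF, nodeK ≠ 0`). [folklore] -/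
theorem jetRatios_eq {Δ tpd tpp c x₀ ε : ℝ} (hg : gradX Δ tpd tpp c x₀ ε ≠ 0) (hF : dcharCubic Δ tpd tpp c x₀ x₀ ε ≠ 0)
    (hK : nodeK Δ tpd tpp c x₀ ε ≠ 0) :
    jetTpp Δ tpd tpp c x₀ ε / jetT Δ tpd tpp c x₀ ε = -nodeV Δ tpd tpp c x₀ ε / (4 * nodeK Δ tpd tpp c x₀ ε) ∧
      jetTp Δ tpd tpp c x₀ ε / jetT Δ tpd tpp c x₀ ε =
        -(nodeW Δ tpd tpp c x₀ ε + 2 * nodeV Δ tpd tpp c x₀ ε) / (4 * nodeK Δ tpd tpp c x₀ ε) := by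
  have hP : jetP Δ tpd tpp c x₀ x₀ ε ≠ 0 := by
    unfold jetP; exact div_ne_zero hg hF
  rw [jetTpp_eq_nodeV, jetTp_eq_nodeW hg, jetT_eq_nodeK hg hF]
  constructor
  · field_simp
    ring
  · field_simp
    ring

/-! ## §2 The program and its link to the tree's definitions -/

/-- One evaluation step with a named head value. [folklore] -/
theorem Prog.eval_cons_eq {θ : Pt5} {env : List ℝ} {f : RExpr} {rest : Prog} {y : ℝ} {out : List ℝ} (hy : f.eval θ env = y)
    (h : Prog.eval θ (y :: env) rest = out) : Prog.eval θ env (f :: rest) = out := by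
  subst hy; exact h

/-- **The nodal-jet program** (node-factorised form): `fsN1`; `x₀ = ε(Δ+ε)/(2fsN1)` (= `xNode`); `∂_εF` at the node as the PRODUCT `(Δ + 2ε − 4(t_pp − t_pp′)x₀)(Δ + ε + 4(t_pp + t_pp′)x₀)` (`jetFe_node`); `gradX` at the node as `4(Δ + ε)(t_pd² + t_pp ε)` (`gradX_node`); `dgradX`, `taylor2` literally; then `jetP = gradX/∂_εF`, `nodeV = (dgradX − taylor2·jetP)/∂_εF`, `nodeW = 8(t_pp + t_pp′)fsN1/gradX` (= `16fsN/gradX`), `m = 1/2 − x₀`, `nodeK = 1 + (4jetV + nodeW)m`, `t_J = jetP·nodeK/4`, `ρ″ = −nodeV/(4jetK)`, `ρ′ = −(nodeW + 2jetV)/(4jetK)` — variables `0 … 4` = `(Δ, t_pd, t_pp, t_pp′, ε)`; stack top first: `ρ′, ρ″, t_J, nodeK, m, nodeW, nodeV, jetP, taylor2, dgradX, gradX, ∂_εF, x₀, fsN1`. [folklore] -/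
def jetProg : Prog := [
  -- 0: fsN1
  RExpr.add (RExpr.mul (RExpr.const 4) (RExpr.sqr (RExpr.var 1))) (RExpr.mul (RExpr.mul (RExpr.const 2) (RExpr.var 4)) (RExpr.sub (RExpr.var 2) (RExpr.var 3))),
  -- 1: xNode
  RExpr.div (RExpr.mul (RExpr.var 4) (RExpr.add (RExpr.var 0) (RExpr.var 4))) (RExpr.mul (RExpr.const 2) (RExpr.ref 0)),
  -- 2: dcharCubic
  RExpr.mul (RExpr.sub (RExpr.add (RExpr.var 0) (RExpr.mul (RExpr.const 2) (RExpr.var 4))) (RExpr.mul (RExpr.mul (RExpr.const 4) (RExpr.sub (RExpr.var 2) (RExpr.var 3))) (RExpr.ref 0))) (RExpr.add (RExpr.add (RExpr.var 0) (RExpr.var 4)) (RExpr.mul (RExpr.mul (RExpr.const 4) (RExpr.add (RExpr.var 2) (RExpr.var 3))) (RExpr.ref 0))),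
  -- 3: gradX
  RExpr.mul (RExpr.mul (RExpr.const 4) (RExpr.add (RExpr.var 0) (RExpr.var 4))) (RExpr.add (RExpr.sqr (RExpr.var 1)) (RExpr.mul (RExpr.var 2) (RExpr.var 4))),
  -- 4: dgradX
  RExpr.add (RExpr.mul (RExpr.const 4) (RExpr.sub (RExpr.sqr (RExpr.var 1)) (RExpr.mul (RExpr.var 3) (RExpr.add (RExpr.var 0) (RExpr.mul (RExpr.const 2) (RExpr.var 4)))))) (RExpr.mul (RExpr.mul (RExpr.const 16) (RExpr.sub (RExpr.sqr (RExpr.var 2)) (RExpr.sqr (RExpr.var 3)))) (RExpr.ref 2)),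
  -- 5: taylor2
  RExpr.add (RExpr.add (RExpr.mul (RExpr.const 3) (RExpr.var 4)) (RExpr.mul (RExpr.const 2) (RExpr.var 0))) (RExpr.mul (RExpr.mul (RExpr.const 8) (RExpr.var 3)) (RExpr.ref 3)),
  -- 6: jetP
  RExpr.div (RExpr.ref 2) (RExpr.ref 3),
  -- 7: jetV
  RExpr.div (RExpr.sub (RExpr.ref 2) (RExpr.mul (RExpr.ref 1) (RExpr.ref 0))) (RExpr.ref 4),
  -- 8: jetW
  RExpr.div (RExpr.mul (RExpr.mul (RExpr.const 8) (RExpr.add (RExpr.var 2) (RExpr.var 3))) (RExpr.ref 7)) (RExpr.ref 4),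
  -- 9: jetM
  RExpr.sub (RExpr.div (RExpr.const 1) (RExpr.const 2)) (RExpr.ref 7),
  -- 10: jetK
  RExpr.add (RExpr.const 1) (RExpr.mul (RExpr.add (RExpr.mul (RExpr.const 4) (RExpr.ref 2)) (RExpr.ref 1)) (RExpr.ref 0)),
  -- 11: jetT
  RExpr.div (RExpr.mul (RExpr.ref 4) (RExpr.ref 0)) (RExpr.const 4),
  -- 12: rho2
  RExpr.div (RExpr.neg (RExpr.ref 4)) (RExpr.mul (RExpr.const 4) (RExpr.ref 1)),
  -- 13: rho1
  RExpr.div (RExpr.neg (RExpr.add (RExpr.ref 4) (RExpr.mul (RExpr.const 2) (RExpr.ref 5)))) (RExpr.mul (RExpr.const 4) (RExpr.ref 2))]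

/-- The named real stack of `jetProg` at `(Δ, a, b, c, e)` (top first; `x₀ = xNode Δ a b c e`). [folklore] -/
noncomputable def jetStack (Δ a b c e : ℝ) : List ℝ :=
  [-(nodeW Δ a b c (xNode Δ a b c e) e + 2 * nodeV Δ a b c (xNode Δ a b c e) e) / (4 * nodeK Δ a b c (xNode Δ a b c e) e),
   -nodeV Δ a b c (xNode Δ a b c e) e / (4 * nodeK Δ a b c (xNode Δ a b c e) e),
   jetP Δ a b c (xNode Δ a b c e) (xNode Δ a b c e) e * nodeK Δ a b c (xNode Δ a b c e) e / 4,
   nodeK Δ a b c (xNode Δ a b c e) e,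
   1 / 2 - (xNode Δ a b c e),
   nodeW Δ a b c (xNode Δ a b c e) e,
   nodeV Δ a b c (xNode Δ a b c e) e,
   jetP Δ a b c (xNode Δ a b c e) (xNode Δ a b c e) e,
   taylor2 Δ c (xNode Δ a b c e) (xNode Δ a b c e) e,
   dgradX Δ a b c (xNode Δ a b c e) e,
   gradX Δ a b c (xNode Δ a b c e) e,
   dcharCubic Δ a b c (xNode Δ a b c e) (xNode Δ a b c e) e,
   xNode Δ a b c e,
   fsN1 a b c e]

/-- **The real semantics of `jetProg` IS the named stack** (`fsN1 ≠ 0`): fourteen one-line algebra steps — the transcription is checked, not trusted. [folklore] -/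
theorem jetProg_eval (Δ a b c e : ℝ) (hn : fsN1 a b c e ≠ 0) : Prog.eval ⟨Δ, a, b, c, e⟩ [] jetProg = jetStack Δ a b c e := by
  unfold jetProg jetStack
  refine Prog.eval_cons_eq ?_ (Prog.eval_cons_eq ?_ (Prog.eval_cons_eq ?_ (Prog.eval_cons_eq ?_ (Prog.eval_cons_eq ?_ (Prog.eval_cons_eq ?_ (Prog.eval_cons_eq ?_ (Prog.eval_cons_eq ?_ (Prog.eval_cons_eq ?_ (Prog.eval_cons_eq ?_ (Prog.eval_cons_eq ?_ (Prog.eval_cons_eq ?_ (Prog.eval_cons_eq ?_ (Prog.eval_cons_eq ?_ (rfl))))))))))))))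
  · -- 0: fsN1
    simp only [RExpr.eval, Pt5.get, fsN1]; push_cast; ring
  · -- 1: xNode
    simp only [RExpr.eval, envGet, Pt5.get, xNode, fsD1]; push_cast; ring
  · -- 2: dcharCubic
    simp only [RExpr.eval, envGet, Pt5.get]
    rw [← jetFe_node Δ a b c e hn]
    push_cast; ring
  · -- 3: gradX
    simp only [RExpr.eval, Pt5.get]
    rw [← gradX_node Δ a b c e hn]
    push_cast; ring
  · -- 4: dgradX
    simp only [RExpr.eval, envGet, Pt5.get, dgradX, dfsD, dfsN]; push_cast; ring
  · -- 5: taylor2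
    simp only [RExpr.eval, envGet, Pt5.get, taylor2]; push_cast; ring
  · -- 6: jetP
    simp only [RExpr.eval, envGet, jetP]
  · -- 7: jetV
    simp only [RExpr.eval, envGet, nodeV]
  · -- 8: jetW
    simp only [RExpr.eval, envGet, Pt5.get, nodeW, fsN, fsN1]; push_cast; ring
  · -- 9: jetM
    simp only [RExpr.eval, envGet]; push_cast; ring
  · -- 10: jetK
    simp only [RExpr.eval, envGet, nodeK]; push_cast; ring
  · -- 11: jetT
    simp only [RExpr.eval, envGet]; push_cast; ring
  · -- 12: rho2
    simp only [RExpr.eval, envGet]; push_cast; ring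
  · -- 13: rho1
    simp only [RExpr.eval, envGet]; push_cast; ring

/-! ## §3 The window leaf and the box theorem -/

/-- A window for the nodal-jet one-band set: scaled-integer (÷ 2⁴⁸) bounds for `t_J` (eV), `ρ′ = t′_J/t_J`, `ρ″ = t″_J/t_J`. [folklore] -/
structure JWin where
  /-- lower bound of `t_J`, scaled -/
  tlo : ℤ
  /-- upper bound of `t_J`, scaled -/
  thi : ℤ
  /-- lower bound of `t′_J/t_J`, scaled -/
  p1lo : ℤ
  /-- upper bound of `t′_J/t_J`, scaled -/
  p1hi : ℤ
  /-- lower bound of `t″_J/t_J`, scaled -/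
  p2lo : ℤ
  /-- upper bound of `t″_J/t_J`, scaled -/
  p2hi : ℤ

/-- **`jetLeaf`** — evaluate `jetProg` in slope arithmetic on `(B, B.cen)`; require positive enclosures of `fsN1` (stack entry 13), `gradX` (10), `∂_εF` (11),
`nodeK` (3); compare the enclosures of `t_J` (entry 2), `ρ′` (entry 0), `ρ″` (entry 1) with the window. [folklore] -/
def jetLeaf (W : JWin) (B : Box5) : Bool :=
  match Prog.evalS B B.cen [] jetProg with
  | some out =>
    decide (0 < (envGet SNode.zero out 13).val.lo) && decide (0 < (envGet SNode.zero out 10).val.lo) &&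
    decide (0 < (envGet SNode.zero out 11).val.lo) && decide (0 < (envGet SNode.zero out 3).val.lo) &&
    decide (W.tlo ≤ (envGet SNode.zero out 2).val.lo) && decide ((envGet SNode.zero out 2).val.hi ≤ W.thi) &&
    decide (W.p1lo ≤ (envGet SNode.zero out 0).val.lo) && decide ((envGet SNode.zero out 0).val.hi ≤ W.p1hi) &&
    decide (W.p2lo ≤ (envGet SNode.zero out 1).val.lo) && decide ((envGet SNode.zero out 1).val.hi ≤ W.p2hi)
  | none => false

/-- The window statement at a σ point and an energy: with `x₀ = xNode(ε)`, `t_J ∈ [tlo, thi]/SC`, `t′_J/t_J ∈ [p1lo, p1hi]/SC`, `t″_J/t_J ∈ [p2lo, p2hi]/SC`.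
[folklore] -/
def JetIn (W : JWin) (Δ a b c e : ℝ) : Prop :=
  (W.tlo : ℝ) / SC ≤ jetT Δ a b c (xNode Δ a b c e) e ∧ jetT Δ a b c (xNode Δ a b c e) e ≤ (W.thi : ℝ) / SC ∧
  (W.p1lo : ℝ) / SC ≤ jetTp Δ a b c (xNode Δ a b c e) e / jetT Δ a b c (xNode Δ a b c e) e ∧
    jetTp Δ a b c (xNode Δ a b c e) e / jetT Δ a b c (xNode Δ a b c e) e ≤ (W.p1hi : ℝ) / SC ∧
  (W.p2lo : ℝ) / SC ≤ jetTpp Δ a b c (xNode Δ a b c e) e / jetT Δ a b c (xNode Δ a b c e) e ∧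
    jetTpp Δ a b c (xNode Δ a b c e) e / jetT Δ a b c (xNode Δ a b c e) e ≤ (W.p2hi : ℝ) / SC

/-- Reading a two-sided scaled bound off an enclosure. [folklore] -/
theorem bounds_of_mem {x : ℝ} {I : FI} {lo hi : ℤ} (hx : FI.mem x I) (h1 : lo ≤ I.lo) (h2 : I.hi ≤ hi) :
    (lo : ℝ) / SC ≤ x ∧ x ≤ (hi : ℝ) / SC := by
  constructor
  · have := FI.lo_div_le hx
    exact le_trans (div_le_div_of_nonneg_right (by exact_mod_cast h1) SC_pos.le) this
  · have := FI.le_hi_div hx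
    exact le_trans this (div_le_div_of_nonneg_right (by exact_mod_cast h2) SC_pos.le)

/-- **Soundness of the leaf**: `jetLeaf W B = true` ⇒ `JetIn W` at every point of `B`. [folklore] -/
theorem jetIn_of_jetLeaf {W : JWin} {B : Box5} (h : jetLeaf W B = true) {Δ a b c e : ℝ} (hθ : B.mem ⟨Δ, a, b, c, e⟩) : JetIn W Δ a b c e := by
  unfold jetLeaf at h
  split at h
  · rename_i out hout
    simp only [Bool.and_eq_true, decide_eq_true_eq] at h
    obtain ⟨⟨⟨⟨⟨⟨⟨⟨⟨hn, hg⟩, hF⟩, hK⟩, h1⟩, h2⟩, h3⟩, h4⟩, h5⟩, h6⟩ := h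
    have m13 := Prog.mem_of_evalS hout hθ 13
    have hn' : fsN1 a b c e ≠ 0 := by
      have e13 : envGet 0 (Prog.eval ⟨Δ, a, b, c, e⟩ [] jetProg) 13 = fsN1 a b c e := by
        simp only [jetProg, Prog.eval, RExpr.eval, envGet, Pt5.get, fsN1]; push_cast; ring
      rw [e13] at m13
      exact (FI.pos_of_lo_pos m13 hn).ne'
    have m0 := Prog.mem_of_evalS hout hθ 0
    have m1 := Prog.mem_of_evalS hout hθ 1
    have m2 := Prog.mem_of_evalS hout hθ 2
    have m3 := Prog.mem_of_evalS hout hθ 3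
    have m10 := Prog.mem_of_evalS hout hθ 10
    have m11 := Prog.mem_of_evalS hout hθ 11
    rw [jetProg_eval Δ a b c e hn'] at m0 m1 m2 m3 m10 m11
    simp only [jetStack, envGet] at m0 m1 m2 m3 m10 m11
    have hg' := (FI.pos_of_lo_pos m10 hg).ne'
    have hF' := (FI.pos_of_lo_pos m11 hF).ne'
    have hK' := (FI.pos_of_lo_pos m3 hK).ne'
    obtain ⟨r2, r1⟩ := jetRatios_eq hg' hF' hK'
    rw [← jetT_eq_nodeK hg' hF'] at m2
    rw [← r2] at m1
    rw [← r1] at m0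
    obtain ⟨a1, a2⟩ := bounds_of_mem m2 h1 h2
    obtain ⟨a3, a4⟩ := bounds_of_mem m0 h3 h4
    obtain ⟨a5, a6⟩ := bounds_of_mem m1 h5 h6
    exact ⟨a1, a2, a3, a4, a5, a6⟩
  · exact absurd h (by simp)

/-- **THE BOX THEOREM**: a passing bisection certificate `Box5.deep (jetLeaf W) n B = true` gives `JetIn W` at every σ point and energy in `B`. [folklore] -/
theorem jetWindow_of_deep {W : JWin} {n : ℕ} {B : Box5} (h : Box5.deep (jetLeaf W) n B = true) {Δ a b c e : ℝ} (hθ : B.mem ⟨Δ, a, b, c, e⟩) :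
    JetIn W Δ a b c e :=
  Box5.forall_of_deep (P := fun p => JetIn W p.x0 p.x1 p.x2 p.x3 p.x4) (fun _ hB' p hp => jetIn_of_jetLeaf (Δ := p.x0) hB' hp) n B h ⟨Δ, a, b, c, e⟩ hθ


/-- **Widening to real bounds**: a `JetIn` window implies any enclosing real window (side conditions `t₁·SC ≤ tlo`, … — `norm_num [SC]` in consumers).
[folklore] -/
theorem JetIn.widen {W : JWin} {Δ a b c e : ℝ} (h : JetIn W Δ a b c e) {t₁ t₂ p₁ p₂ q₁ q₂ : ℝ} (h1 : t₁ * SC ≤ W.tlo) (h2 : (W.thi : ℝ) ≤ t₂ * SC)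
    (h3 : p₁ * SC ≤ W.p1lo) (h4 : (W.p1hi : ℝ) ≤ p₂ * SC) (h5 : q₁ * SC ≤ W.p2lo) (h6 : (W.p2hi : ℝ) ≤ q₂ * SC) :
    jetT Δ a b c (xNode Δ a b c e) e ∈ Icc t₁ t₂ ∧
      jetTp Δ a b c (xNode Δ a b c e) e / jetT Δ a b c (xNode Δ a b c e) e ∈ Icc p₁ p₂ ∧
      jetTpp Δ a b c (xNode Δ a b c e) e / jetT Δ a b c (xNode Δ a b c e) e ∈ Icc q₁ q₂ := by
  obtain ⟨a1, a2, a3, a4, a5, a6⟩ := h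
  have l : ∀ {u : ℝ} {k : ℤ} {y : ℝ}, u * SC ≤ k → (k : ℝ) / SC ≤ y → u ≤ y := fun hu hy =>
    le_trans ((le_div_iff₀ SC_pos).2 hu) hy
  have r : ∀ {u : ℝ} {k : ℤ} {y : ℝ}, (k : ℝ) ≤ u * SC → y ≤ (k : ℝ) / SC → y ≤ u := fun hu hy =>
    le_trans hy ((div_le_iff₀ SC_pos).2 hu)
  exact ⟨⟨l h1 a1, r h2 a2⟩, ⟨l h3 a3, r h4 a4⟩, ⟨l h5 a5, r h6 a6⟩⟩

/-! ## §4 Feeding typed intervals -/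

/-- The `FI` spanning the rational interval `[p₁/q₁, p₂/q₂]` (outward: `⌊p₁2⁴⁸/q₁⌋`, `⌈p₂2⁴⁸/q₂⌉`). [folklore] -/
def fiIcc (p₁ : ℤ) (q₁ : ℕ) (p₂ : ℤ) (q₂ : ℕ) : FI := ⟨(FI.ofFrac p₁ q₁).lo, (FI.ofFrac p₂ q₂).hi⟩

/-- A real in `[lo, hi]` with `p₁/q₁ ≤ lo`, `hi ≤ p₂/q₂` lies in `fiIcc p₁ q₁ p₂ q₂` (`q₁, q₂ > 0`). [folklore] -/
theorem mem_fiIcc_of_le {x lo hi : ℝ} {p₁ p₂ : ℤ} {q₁ q₂ : ℕ} (hq₁ : 0 < q₁) (hq₂ : 0 < q₂) (h1 : (p₁ : ℝ) / q₁ ≤ lo) (h2 : hi ≤ (p₂ : ℝ) / q₂)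
    (h : x ∈ Icc lo hi) : FI.mem x (fiIcc p₁ q₁ p₂ q₂) := by
  have hu := FI.mem_ofFrac p₁ hq₁
  have hv := FI.mem_ofFrac p₂ hq₂
  exact ⟨hu.1.trans (mul_le_mul_of_nonneg_right (h1.trans h.1) SC_pos.le), (mul_le_mul_of_nonneg_right (h.2.trans h2) SC_pos.le).trans hv.2⟩

end Summit.Ventures.CertifiedManyBodySolver.Downfold.Emery
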